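import Mathlib
import Literature.Analysis.SpecialFunctions.DigammaVerticalSeries
import Literature.Analysis.SpecialFunctions.DigammaLogBound
import Literature.NumberTheory.LFunctions.WeilMarkovQuadratic
import Literature.NumberTheory.LFunctions.YoshidaWindowGram
import HarnessLib

/-!
# The far constant grows exponentially with the window: `(7/5)·e^a − 12a + 11 ≤ 2a·A` for every `a ≥ 3`

Helper file (`--supports stmt-RiemannHypothesis-0098`, lead-track anchor: Weil-positivity window ladder, format-C far bound),
RH-free, pure proofs, Mathlib only.  Seat rh-explicit-weil-1 gen8 (memo `run/shared/lean/pub/rh-explicit/rh-explicit-weil-1/FORMAT-K3.md` §9).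

Every format-C door consumes a uniform FAR constant `A` of its window `[−a, a]` — `Σ_{n<N} 2Λ(n)/√n ∫ f(x − log n) f(x) dx ≤ A ∫ f²`
for all real measurable bounded `f` vanishing off `[−a, a]` (`e^{2a} ≤ N`).  Testing on the window's indicator gives
`Σ_{n<N} 2Λ(n)/√n · max(2a − log n, 0) ≤ 2a·A` for every `a ≥ 0` (`le_of_shiftBound_indicator`); keeping only the prime powers of
the two shells `(e^{2a−4}, e^{2a−2}]` and `(e^{2a−6}, e^{2a−4}]` and Chebyshev's explicit bounds from Mathlib (`Chebyshev.psi_ge'`,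
`Chebyshev.psi_le`) gives the window-UNIFORM kernel theorem `far_constant_growth`:  for all `a ≥ 3`,  `(7/5)·e^a − 12a + 11 ≤ 2a·A`.
So any far certificate grows at least like `0.7·e^a/a` (the identified floor law of C-XIII is `λ_max(a) = e^a + 2a − 1 − 2γ_E + ε`;
the per-window two-step bounds of `WeilFarFloorLowerBounds*` are the sharp instances), and the format-C far-weight wall `2a·e^{A}`
is doubly exponential in `a` by a theorem: `door_onset_lower_bound` feeds the growth bound into the diagonal clause `h0e` of the
A-door `WeilFormatC.weilPositivityOn_of_formatC_kernelsA` (stated verbatim as a hypothesis) together with the vertical-strip bound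
`‖ψ(w)‖ ≤ log(1 + ‖w‖) + 8` (`Literature…DigammaLogBound`) and concludes  `(2a/π)·(π·exp((7/5·e^a − 12a + 11)/(2a) − 8) − 9/4) < Be`
— the near-block ONSET of any instantiation of that door at window `a ≥ 3` is at least `(2a/π)(π·e^{0.7e^a/a − 14 + 5.5/a} − 9/4)`,
doubly exponential in the window, whatever far certificate is used (`2.6·10⁴` at `a = 5`, `6.9·10¹⁵` at `6`, `10⁴³` at `7`).
Standard axioms only.
-/

set_option linter.dupNamespace false
set_option autoImplicit false

noncomputable section

open MeasureTheory Set Finset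
open scoped Real BigOperators ArithmeticFunction.vonMangoldt Chebyshev

namespace Summit.RiemannHypothesis.RiemannHypothesis.Theorems.WeilFormatC

namespace FloorGrowth

/-! ### The indicator test (every window) -/

/-- The window indicator's shifted self-overlap: `∫ 1_[−a,a](x − u)·1_[−a,a](x) dx = max(2a − u, 0)` for `u ≥ 0`. -/
theorem integral_indicator_shift_mul (a : ℝ) {u : ℝ} (hu : 0 ≤ u) :
    ∫ x, (Icc (-a) a).indicator (1 : ℝ → ℝ) (x - u) * (Icc (-a) a).indicator 1 x = max (2 * a - u) 0 := by
  have hshift : ∀ x, (Icc (-a) a).indicator (1 : ℝ → ℝ) (x - u) = (Icc (-a + u) (a + u)).indicator 1 x := by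
    intro x
    by_cases h : x - u ∈ Icc (-a) a
    · have h' : x ∈ Icc (-a + u) (a + u) := ⟨by linarith [h.1], by linarith [h.2]⟩
      rw [Set.indicator_of_mem h, Set.indicator_of_mem h']; rfl
    · have h' : x ∉ Icc (-a + u) (a + u) := fun h' ↦ h ⟨by linarith [h'.1], by linarith [h'.2]⟩
      rw [Set.indicator_of_notMem h, Set.indicator_of_notMem h']
  have hprod : (fun x ↦ (Icc (-a) a).indicator (1 : ℝ → ℝ) (x - u) * (Icc (-a) a).indicator 1 x)
      = (Icc (-a + u) (a + u) ∩ Icc (-a) a).indicator 1 := by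
    ext x; rw [hshift, inter_indicator_one]; rfl
  rw [hprod, integral_indicator_one (measurableSet_Icc.inter measurableSet_Icc), Icc_inter_Icc, Real.volume_real_Icc]
  have h1 : (-a + u) ⊔ (-a) = -a + u := sup_eq_left.2 (by linarith)
  have h2 : (a + u) ⊓ a = a := inf_eq_right.2 (by linarith)
  rw [h1, h2]
  congr 1; ring

/-- **The indicator lower bound, for every window**: a uniform shift bound `A` of `[−a, a]` in the range-`N` form satisfies
`Σ_{n<N} 2Λ(n)/√n · max(2a − log n, 0) ≤ A · 2a` (test function `1_[−a,a]`). -/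
theorem le_of_shiftBound_indicator {a A : ℝ} (ha : 0 ≤ a) {N : ℕ}
    (hJ : ∀ (f : ℝ → ℝ) (C : ℝ), Measurable f → (∀ x, |f x| ≤ C) → (∀ x, x ∉ Icc (-a) a → f x = 0) →
      ∑ n ∈ Finset.range N, 2 * ((Λ n : ℝ) / Real.sqrt n) * (∫ x, f (x - Real.log n) * f x) ≤ A * ∫ x, f x ^ 2) :
    ∑ n ∈ Finset.range N, 2 * ((Λ n : ℝ) / Real.sqrt n) * max (2 * a - Real.log n) 0 ≤ A * (2 * a) := by
  have hmeas : Measurable ((Icc (-a) a).indicator (1 : ℝ → ℝ)) := measurable_one.indicator measurableSet_Icc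
  have hbd : ∀ x, |(Icc (-a) a).indicator (1 : ℝ → ℝ) x| ≤ 1 := by
    intro x; simp only [Set.indicator_apply, Pi.one_apply]; split_ifs <;> simp
  have hsupp : ∀ x, x ∉ Icc (-a) a → (Icc (-a) a).indicator (1 : ℝ → ℝ) x = 0 :=
    fun x hx ↦ Set.indicator_of_notMem hx _
  have h := hJ _ 1 hmeas hbd hsupp
  have hI : ∀ n : ℕ, ∫ x, (Icc (-a) a).indicator (1 : ℝ → ℝ) (x - Real.log n) * (Icc (-a) a).indicator 1 x
      = max (2 * a - Real.log n) 0 := fun n ↦ integral_indicator_shift_mul a (Real.log_natCast_nonneg n)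
  have h0 : ∫ x, (Icc (-a) a).indicator (1 : ℝ → ℝ) x ^ 2 = 2 * a := by
    have h00 := integral_indicator_shift_mul a (le_refl (0 : ℝ))
    rw [sub_zero, max_eq_left (by linarith)] at h00
    rw [← h00]
    exact integral_congr_ae (Filter.Eventually.of_forall fun x ↦ by simp only [sub_zero, pow_two])
  simp_rw [hI] at h
  rwa [h0] at h

/-! ### Shells of prime powers -/

/-- `ψ` of a natural number as the `Ioc` sum. -/
theorem psi_natCast (m : ℕ) : ψ (m : ℝ) = ∑ n ∈ Finset.Ioc 0 m, Λ n := by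
  rw [Chebyshev.psi, Nat.floor_natCast]

/-- The von Mangoldt mass of the shell `(y, x]`: `Σ_{⌊y⌋ < n ≤ ⌊x⌋} Λ(n) = ψ(x) − ψ(y)` (`y ≤ x`). -/
theorem sum_Ioc_floor_vonMangoldt {x y : ℝ} (hxy : y ≤ x) :
    ∑ n ∈ Finset.Ioc ⌊y⌋₊ ⌊x⌋₊, Λ n = ψ x - ψ y := by
  rw [Chebyshev.psi_eq_psi_coe_floor x, Chebyshev.psi_eq_psi_coe_floor y, psi_natCast, psi_natCast,
    ← Finset.sum_Ioc_consecutive _ (Nat.zero_le ⌊y⌋₊) (Nat.floor_le_floor hxy)]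
  ring

/-- **One shell**: on the prime powers `n` with `e^{2a−2c−2} < n ≤ e^{2a−2c}` (`c ≥ 0`) the indicator weight is at least
`Λ(n)·4c·e^{c−a}`, so the shell carries `(ψ(e^{2a−2c}) − ψ(e^{2a−2c−2}))·4c·e^{c−a}`. -/
theorem shell_le_sum (a : ℝ) {c : ℝ} (hc : 0 ≤ c) :
    (ψ (Real.exp (2 * a - 2 * c)) - ψ (Real.exp (2 * a - 2 * c - 2))) * (4 * c * Real.exp (c - a))
      ≤ ∑ n ∈ Finset.Ioc ⌊Real.exp (2 * a - 2 * c - 2)⌋₊ ⌊Real.exp (2 * a - 2 * c)⌋₊,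
          2 * ((Λ n : ℝ) / Real.sqrt n) * max (2 * a - Real.log n) 0 := by
  have hxy : Real.exp (2 * a - 2 * c - 2) ≤ Real.exp (2 * a - 2 * c) := Real.exp_le_exp.2 (by linarith)
  rw [← sum_Ioc_floor_vonMangoldt hxy, Finset.sum_mul]
  refine Finset.sum_le_sum fun n hn ↦ ?_
  rw [Finset.mem_Ioc] at hn
  have hn1 : 1 ≤ n := by omega
  have hnpos : (0 : ℝ) < n := by exact_mod_cast hn1
  have hnle : (n : ℝ) ≤ Real.exp (2 * a - 2 * c) :=
    (Nat.cast_le.2 hn.2).trans (Nat.floor_le (Real.exp_pos _).le)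
  have hlog : Real.log n ≤ 2 * a - 2 * c := by
    have := Real.log_le_log hnpos hnle
    rwa [Real.log_exp] at this
  have hsqrt : Real.sqrt n ≤ Real.exp (a - c) := by
    rw [Real.sqrt_le_iff]
    refine ⟨(Real.exp_pos _).le, ?_⟩
    rw [← Real.exp_nat_mul]; push_cast
    rw [show (2 : ℝ) * (a - c) = 2 * a - 2 * c by ring]
    exact hnle
  have hsqrt_pos : 0 < Real.sqrt n := Real.sqrt_pos.2 hnpos
  have hΛ : 0 ≤ (Λ n : ℝ) := ArithmeticFunction.vonMangoldt_nonneg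
  have hmax : (2 * c : ℝ) ≤ max (2 * a - Real.log n) 0 := le_max_of_le_left (by linarith)
  have hinv : Real.exp (c - a) ≤ 1 / Real.sqrt n := by
    rw [le_div_iff₀ hsqrt_pos]
    calc Real.exp (c - a) * Real.sqrt n ≤ Real.exp (c - a) * Real.exp (a - c) :=
          mul_le_mul_of_nonneg_left hsqrt (Real.exp_pos _).le
      _ = 1 := by rw [← Real.exp_add]; norm_num
  calc (Λ n : ℝ) * (4 * c * Real.exp (c - a)) = (2 * ((Λ n : ℝ) * Real.exp (c - a))) * (2 * c) := by ring
    _ ≤ (2 * ((Λ n : ℝ) * (1 / Real.sqrt n))) * max (2 * a - Real.log n) 0 := by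
        refine mul_le_mul ?_ hmax (by positivity) (by positivity)
        exact mul_le_mul_of_nonneg_left (mul_le_mul_of_nonneg_left hinv hΛ) (by norm_num)
    _ = 2 * ((Λ n : ℝ) / Real.sqrt n) * max (2 * a - Real.log n) 0 := by ring

/-- **Two shells inside the range sum** (`e^{2a} ≤ N`, `3 ≤ a`): the shells `k = 1, 2` are consecutive sub-intervals of `range N`
and every term of the range sum is nonnegative. -/
theorem two_shells_le_sum {a : ℝ} {N : ℕ} (hN : Real.exp (2 * a) ≤ N) :
    (ψ (Real.exp (2 * a - 2)) - ψ (Real.exp (2 * a - 4))) * (4 * Real.exp (1 - a)) +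
      (ψ (Real.exp (2 * a - 4)) - ψ (Real.exp (2 * a - 6))) * (8 * Real.exp (2 - a))
      ≤ ∑ n ∈ Finset.range N, 2 * ((Λ n : ℝ) / Real.sqrt n) * max (2 * a - Real.log n) 0 := by
  have h1 := shell_le_sum a (c := 1) (by norm_num)
  have h2 := shell_le_sum a (c := 2) (by norm_num)
  rw [show (2 : ℝ) * a - 2 * 1 - 2 = 2 * a - 4 by ring, show (2 : ℝ) * a - 2 * 1 = 2 * a - 2 by ring,
    show (4 : ℝ) * 1 * Real.exp (1 - a) = 4 * Real.exp (1 - a) by ring] at h1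
  rw [show (2 : ℝ) * a - 2 * 2 - 2 = 2 * a - 6 by ring, show (2 : ℝ) * a - 2 * 2 = 2 * a - 4 by ring,
    show (4 : ℝ) * 2 * Real.exp (2 - a) = 8 * Real.exp (2 - a) by ring] at h2
  have hm : ⌊Real.exp (2 * a - 6)⌋₊ ≤ ⌊Real.exp (2 * a - 4)⌋₊ := Nat.floor_le_floor (Real.exp_le_exp.2 (by linarith))
  have hm' : ⌊Real.exp (2 * a - 4)⌋₊ ≤ ⌊Real.exp (2 * a - 2)⌋₊ := Nat.floor_le_floor (Real.exp_le_exp.2 (by linarith))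
  have hunion := Finset.sum_Ioc_consecutive
    (fun n : ℕ ↦ 2 * ((Λ n : ℝ) / Real.sqrt n) * max (2 * a - Real.log n) 0) hm hm'
  have hsub : Finset.Ioc ⌊Real.exp (2 * a - 6)⌋₊ ⌊Real.exp (2 * a - 2)⌋₊ ⊆ Finset.range N := by
    intro n hn
    rw [Finset.mem_Ioc] at hn
    rw [Finset.mem_range]
    have hlt : (⌊Real.exp (2 * a - 2)⌋₊ : ℝ) < N :=
      lt_of_le_of_lt (Nat.floor_le (Real.exp_pos _).le) (lt_of_lt_of_le (Real.exp_lt_exp.2 (by linarith)) hN)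
    exact_mod_cast lt_of_le_of_lt (Nat.cast_le.2 hn.2) hlt
  have hnonneg : ∀ n ∈ Finset.range N, n ∉ Finset.Ioc ⌊Real.exp (2 * a - 6)⌋₊ ⌊Real.exp (2 * a - 2)⌋₊ →
      0 ≤ 2 * ((Λ n : ℝ) / Real.sqrt n) * max (2 * a - Real.log n) 0 := fun n _ _ ↦
    mul_nonneg (mul_nonneg (by norm_num) (div_nonneg ArithmeticFunction.vonMangoldt_nonneg (Real.sqrt_nonneg _)))
      (le_max_right _ _)
  have := Finset.sum_le_sum_of_subset_of_nonneg hsub hnonneg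
  linarith

/-! ### Assembly with Chebyshev's explicit bounds -/

/-- `a·e^{−a} ≤ 3·e^{−3}` for `a ≥ 3` (from `1 + (a − 3) ≤ e^{a−3}`). -/
theorem mul_exp_neg_le {a : ℝ} (ha : 3 ≤ a) : a * Real.exp (-a) ≤ 3 * Real.exp (-3) := by
  have h1 : a - 3 + 1 ≤ Real.exp (a - 3) := Real.add_one_le_exp (a - 3)
  have h3 : a ≤ 3 * Real.exp (a - 3) := by nlinarith [Real.exp_pos (a - 3)]
  have hsplit : Real.exp (-3) = Real.exp (a - 3) * Real.exp (-a) := by rw [← Real.exp_add]; ring_nf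
  rw [hsplit]
  nlinarith [Real.exp_pos (-a), Real.exp_pos (a - 3)]

/-- Numeric envelope of `t = e^{−1}`: powers and the main-term constant `log 2·(4t + 8t² − 4t³ − 16t⁴) ≥ 1.429`. -/
theorem exp_neg_one_envelope :
    Real.exp (-1) ≤ 3679 / 10000 ∧ Real.exp (-1) ^ 2 ≤ 13534 / 100000 ∧
      (1429 / 1000 : ℝ) ≤ Real.log 2 * (4 * Real.exp (-1) + 8 * Real.exp (-1) ^ 2 - 4 * Real.exp (-1) ^ 3
        - 16 * Real.exp (-1) ^ 4) := by
  set t := Real.exp (-1) with ht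
  have htlo := Real.exp_neg_one_gt_d9
  have hthi := Real.exp_neg_one_lt_d9
  have hl2 := Real.log_two_gt_d9
  have ht0 : 0 < t := Real.exp_pos _
  have ht2lo : (13533 / 100000 : ℝ) ≤ t ^ 2 := by nlinarith
  have ht2hi : t ^ 2 ≤ (13534 / 100000 : ℝ) := by nlinarith
  have ht3hi : t ^ 3 ≤ (498 / 10000 : ℝ) := by nlinarith
  have ht4hi : t ^ 4 ≤ (1832 / 100000 : ℝ) := by nlinarith
  have hpoly : (20618 / 10000 : ℝ) ≤ 4 * t + 8 * t ^ 2 - 4 * t ^ 3 - 16 * t ^ 4 := by linarith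
  refine ⟨by linarith, ht2hi, ?_⟩
  nlinarith

/-- Small coefficients for `a ≥ 3`: `e^{1−a} ≤ e^{−2}`, `e^{2−a} ≤ e^{−1}`, `a·e^{1−a} ≤ 3e^{−2}`, `a·e^{2−a} ≤ 3e^{−1}`,
with `e^{−1} ≤ 0.3679`, `e^{−2} ≤ 0.13534`, `e^{−1}·log 2 ≤ 0.2552`. -/
theorem small_coefficients {a : ℝ} (ha : 3 ≤ a) :
    Real.exp (1 - a) ≤ 1354 / 10000 ∧ a * Real.exp (2 - a) ≤ 11037 / 10000 ∧
      Real.exp (2 - a) * Real.log 2 ≤ 2552 / 10000 ∧ Real.exp (2 - a) ≤ 3679 / 10000 := by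
  obtain ⟨ht1, ht2, -⟩ := exp_neg_one_envelope
  have hl2' := Real.log_two_lt_d9
  have hae := mul_exp_neg_le ha
  have hs1 : Real.exp (1 - a) ≤ Real.exp (-1) ^ 2 := by
    rw [← Real.exp_nat_mul]; push_cast; exact Real.exp_le_exp.2 (by linarith)
  have hs2 : Real.exp (2 - a) ≤ Real.exp (-1) := Real.exp_le_exp.2 (by linarith)
  have hs4 : a * Real.exp (2 - a) ≤ 3 * Real.exp (-1) := by
    have e1 : Real.exp (2 - a) = Real.exp 2 * Real.exp (-a) := by rw [← Real.exp_add]; ring_nf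
    have e2 : Real.exp (-1) = Real.exp 2 * Real.exp (-3) := by rw [← Real.exp_add]; norm_num
    rw [e1, e2]
    nlinarith [Real.exp_pos (2 : ℝ)]
  refine ⟨by linarith, by linarith, ?_, by linarith⟩
  nlinarith [Real.exp_pos (2 - a), Real.log_two_gt_d9]

/-- **EXPONENTIAL GROWTH OF THE FAR CONSTANT** (window-uniform; Chebyshev's bounds from Mathlib): for `3 ≤ a`, `e^{2a} ≤ N` and
every uniform shift bound `A` of `[−a, a]` in the range-`N` form,  `(7/5)·e^a − 12a + 11 ≤ 2a·A`. -/
theorem far_constant_growth {a A : ℝ} (ha : 3 ≤ a) {N : ℕ} (hN : Real.exp (2 * a) ≤ N)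
    (hJ : ∀ (f : ℝ → ℝ) (C : ℝ), Measurable f → (∀ x, |f x| ≤ C) → (∀ x, x ∉ Icc (-a) a → f x = 0) →
      ∑ n ∈ Finset.range N, 2 * ((Λ n : ℝ) / Real.sqrt n) * (∫ x, f (x - Real.log n) * f x) ≤ A * ∫ x, f x ^ 2) :
    (7 / 5) * Real.exp a - 12 * a + 11 ≤ 2 * a * A := by
  obtain ⟨ht1, -, hmain⟩ := exp_neg_one_envelope
  obtain ⟨q1, q4, q3, q5⟩ := small_coefficients ha
  have htlo := Real.exp_neg_one_gt_d9
  have hind := le_of_shiftBound_indicator (by linarith) hJ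
  have hsh := two_shells_le_sum hN
  set E := Real.exp a with hE
  set t := Real.exp (-1) with ht
  have hEpos : 0 < E := Real.exp_pos a
  -- coefficients are nonnegative
  have hc1 : 0 ≤ 4 * Real.exp (1 - a) := by positivity
  have hc21 : 0 ≤ 8 * Real.exp (2 - a) - 4 * Real.exp (1 - a) := by
    have : Real.exp (1 - a) ≤ Real.exp (2 - a) := Real.exp_le_exp.2 (by linarith)
    linarith [Real.exp_pos (1 - a)]
  have hc2 : 0 ≤ 8 * Real.exp (2 - a) := by positivity
  -- product identities
  have p11 : Real.exp (1 - a) * Real.exp (2 * a - 2) = E * t := by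
    rw [hE, ht, ← Real.exp_add, ← Real.exp_add]; congr 1; ring
  have p12 : Real.exp (1 - a) * Real.exp (2 * a - 4) = E * t ^ 3 := by
    rw [hE, ht, ← Real.exp_nat_mul, ← Real.exp_add, ← Real.exp_add]; congr 1; push_cast; ring
  have p22 : Real.exp (2 - a) * Real.exp (2 * a - 4) = E * t ^ 2 := by
    rw [hE, ht, ← Real.exp_nat_mul, ← Real.exp_add, ← Real.exp_add]; congr 1; push_cast; ring
  have p23 : Real.exp (2 - a) * Real.exp (2 * a - 6) = E * t ^ 4 := by
    rw [hE, ht, ← Real.exp_nat_mul, ← Real.exp_add, ← Real.exp_add]; congr 1; push_cast; ring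
  have p2s : Real.exp (2 - a) * (E * Real.exp (-3)) = t := by
    rw [hE, ht, ← Real.exp_add, ← Real.exp_add]; congr 1; ring
  -- Chebyshev at the shell ends
  have hu1 : 1 ≤ Real.exp (2 * a - 2) := Real.one_le_exp (by linarith)
  have hu2 : 1 ≤ Real.exp (2 * a - 4) := Real.one_le_exp (by linarith)
  have hu3 : 1 ≤ Real.exp (2 * a - 6) := Real.one_le_exp (by linarith)
  have hlogadd : ∀ u : ℝ, 1 ≤ u → Real.log (u + 2) ≤ Real.log u + 2 := by
    intro u hu
    have hq : Real.log ((u + 2) / u) ≤ (u + 2) / u - 1 := Real.log_le_sub_one_of_pos (by positivity)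
    rw [Real.log_div (by linarith) (by linarith)] at hq
    have : (u + 2) / u - 1 = 2 / u := by field_simp; ring
    rw [this] at hq
    have h2u : 2 / u ≤ 2 := by rw [div_le_iff₀ (by linarith)]; linarith
    linarith
  have hψ1 : (Real.exp (2 * a - 2) - 1) * Real.log 2 - ((2 * a - 2) + 2) ≤ ψ (Real.exp (2 * a - 2)) := by
    have h := Chebyshev.psi_ge' (x := Real.exp (2 * a - 2)) (by positivity)
    have h' := hlogadd _ hu1
    rw [Real.log_exp] at h'
    linarith
  have hψ2 : (Real.exp (2 * a - 4) - 1) * Real.log 2 - ((2 * a - 4) + 2) ≤ ψ (Real.exp (2 * a - 4)) := by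
    have h := Chebyshev.psi_ge' (x := Real.exp (2 * a - 4)) (by positivity)
    have h' := hlogadd _ hu2
    rw [Real.log_exp] at h'
    linarith
  have hψ3 : ψ (Real.exp (2 * a - 6)) ≤ 2 * Real.log 2 * Real.exp (2 * a - 6) + 2 * (E * Real.exp (-3)) * (2 * a - 6) := by
    have h := Chebyshev.psi_le (x := Real.exp (2 * a - 6)) hu3
    have hs : Real.sqrt (Real.exp (2 * a - 6)) = E * Real.exp (-3) := by
      have : Real.exp (2 * a - 6) = (E * Real.exp (-3)) ^ 2 := by
        rw [hE, ← Real.exp_add, ← Real.exp_nat_mul]; congr 1; push_cast; ring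
      rw [this, Real.sqrt_sq (by positivity)]
    have hlog4 : Real.log 4 = 2 * Real.log 2 := by
      rw [show (4 : ℝ) = 2 ^ 2 by norm_num, Real.log_pow]; norm_num
    rw [hs, Real.log_exp, hlog4] at h
    exact h
  -- multiply the three Chebyshev bounds by their (nonnegative) coefficients
  have m1 := mul_le_mul_of_nonneg_left hψ1 hc1
  have m2 := mul_le_mul_of_nonneg_left hψ2 hc21
  have m3 := mul_le_mul_of_nonneg_left hψ3 hc2
  -- product identities with the logarithm attached (linear atoms for `linarith`)
  have p11L : Real.exp (1 - a) * Real.exp (2 * a - 2) * Real.log 2 = E * t * Real.log 2 := by rw [p11]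
  have p12L : Real.exp (1 - a) * Real.exp (2 * a - 4) * Real.log 2 = E * t ^ 3 * Real.log 2 := by rw [p12]
  have p22L : Real.exp (2 - a) * Real.exp (2 * a - 4) * Real.log 2 = E * t ^ 2 * Real.log 2 := by rw [p22]
  have p23L : Real.exp (2 - a) * Real.exp (2 * a - 6) * Real.log 2 = E * t ^ 4 * Real.log 2 := by rw [p23]
  have p2sa : Real.exp (2 - a) * (E * Real.exp (-3)) * a = t * a := by rw [p2s]
  have hmainE : (1429 / 1000 : ℝ) * E ≤ E * (Real.log 2 * (4 * t + 8 * t ^ 2 - 4 * t ^ 3 - 16 * t ^ 4)) := by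
    have := mul_le_mul_of_nonneg_left hmain hEpos.le; linarith
  have q7 : t * a ≤ (3 / 8) * a := mul_le_mul_of_nonneg_right (by linarith) (by linarith)
  have hc2' : 0 ≤ Real.exp (2 - a) := (Real.exp_pos _).le
  -- collect
  linarith [m1, m2, m3, p11L, p12L, p22L, p23L, p2s, p2sa, hmainE, q3, q4, q1, q7, hc2', htlo]

/-! ### Consequence for the format-C A-door: the near-block onset is doubly exponential in the window -/

open Literature.NumberTheory.LFunctions Literature.NumberTheory.LFunctions.Yoshida1992
  Literature.Analysis.SpecialFunctions in
/-- **BARRIER FOR THE A-DOOR** (`WeilFormatC.weilPositivityOn_of_formatC_kernelsA`): its diagonal clause `h0e` at near-block onset `Be`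
(hypothesis verbatim) forces `A < Re ψ(¼ + i·πBe/(2a)) − log π`; with `‖ψ(w)‖ ≤ log(1 + ‖w‖) + 8` on the strip and the growth theorem,
every instantiation at a window `a ≥ 3` (any far certificate `A` of `[−a, a]`, `e^{2a} ≤ N`) has
`(2a/π)·(π·exp((7/5·e^a − 12a + 11)/(2a) − 8) − 9/4) < Be`. -/
theorem door_onset_lower_bound {a A : ℝ} (ha : 3 ≤ a) {N : ℕ} (hN : Real.exp (2 * a) ≤ N)
    (hJ : ∀ (f : ℝ → ℝ) (C : ℝ), Measurable f → (∀ x, |f x| ≤ C) → (∀ x, x ∉ Icc (-a) a → f x = 0) →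
      ∑ n ∈ Finset.range N, 2 * ((Λ n : ℝ) / Real.sqrt n) * (∫ x, f (x - Real.log n) * f x) ≤ A * ∫ x, f x ^ 2)
    {Be : ℕ} (hBe : 2 ≤ Be)
    (h0e : 0 < ((reDigammaQuarter (freq a Be) - Real.log π) / 2
      - a * (1 + weilArchDensity (2 * a)) / (π ^ 2 * Be ^ 2) - 1 / (8 * Be)
      - a * (1 + weilArchDensity (2 * a)) / π ^ 2 * Real.sqrt (8 / ((Be - 1 : ℕ) : ℝ)) - A / 2)) :
    2 * a / π * (π * Real.exp (((7 / 5) * Real.exp a - 12 * a + 11) / (2 * a) - 8) - 9 / 4) < Be := by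
  have hgrowth := far_constant_growth ha hN hJ
  have hapos : 0 < a := by linarith
  have hBe0 : (0 : ℝ) < Be := by exact_mod_cast (by omega : 0 < Be)
  -- the subtracted terms of the clause are nonnegative
  have hρ : 0 < 1 + weilArchDensity (2 * a) := by linarith [weilArchDensity_pos (by linarith : (0 : ℝ) < 2 * a)]
  have hC : 0 ≤ a * (1 + weilArchDensity (2 * a)) := by positivity
  have t1 : 0 ≤ a * (1 + weilArchDensity (2 * a)) / (π ^ 2 * Be ^ 2) := by positivity
  have t2 : 0 ≤ 1 / (8 * (Be : ℝ)) := by positivity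
  have t3 : 0 ≤ a * (1 + weilArchDensity (2 * a)) / π ^ 2 * Real.sqrt (8 / ((Be - 1 : ℕ) : ℝ)) := by positivity
  have hA : A < reDigammaQuarter (freq a Be) - Real.log π := by linarith
  -- Re ψ(¼ + it/2) ≤ log(7/4 + t/2) + 8 for t = π Be / a ≥ 0, via monotonicity and the strip bound at max(t, 1)
  set t := freq a Be with ht_def
  have ht0 : 0 ≤ t := by rw [ht_def, freq]; positivity
  set u := max t 1 with hu
  have hu1 : 1 ≤ u := le_max_right _ _
  have htu : |t| ≤ |u| := by rw [abs_of_nonneg ht0, abs_of_nonneg (by linarith)]; exact le_max_left _ _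
  have hmono : reDigammaQuarter t ≤ reDigammaQuarter u := reDigammaQuarter_mono htu
  have hstrip : reDigammaQuarter u ≤ Real.log (7 / 4 + u / 2) + 8 := by
    have hw : (0 : ℝ) < ((1 : ℂ) / 4 + (u : ℂ) / 2 * Complex.I).re := by simp
    have hwi : ((1 : ℂ) / 4 + (u : ℂ) / 2 * Complex.I).im = u / 2 := by simp
    have hy : (1 : ℝ) / 2 ≤ |((1 : ℂ) / 4 + (u : ℂ) / 2 * Complex.I).im| := by
      rw [hwi, abs_of_nonneg (by linarith)]; linarith
    have h := Literature.Analysis.SpecialFunctions.Complex.norm_digamma_le_log hw hy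
    have hre : reDigammaQuarter u ≤ ‖Complex.digamma (1 / 4 + (u : ℂ) / 2 * Complex.I)‖ := by
      unfold reDigammaQuarter; exact Complex.re_le_norm _
    have hnorm : ‖(1 : ℂ) / 4 + (u : ℂ) / 2 * Complex.I‖ ≤ 1 / 4 + u / 2 := by
      refine (Complex.norm_le_abs_re_add_abs_im _).trans ?_
      rw [hwi]; simp [abs_of_nonneg (show (0:ℝ) ≤ u / 2 by linarith)]
    have hlog : Real.log (1 + ‖(1 : ℂ) / 4 + (u : ℂ) / 2 * Complex.I‖) ≤ Real.log (7 / 4 + u / 2) :=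
      Real.log_le_log (by positivity) (by linarith)
    linarith
  have hu_le : u / 2 ≤ t / 2 + 1 / 2 := by
    rcases le_or_gt t 1 with h | h
    · rw [hu, max_eq_right h]; linarith
    · rw [hu, max_eq_left h.le]; linarith
  have hlogmono : Real.log (7 / 4 + u / 2) ≤ Real.log (9 / 4 + t / 2) :=
    Real.log_le_log (by positivity) (by linarith)
  -- combine: (growth)/(2a) ≤ A < log(9/4 + t/2) + 8 − log π
  have hA2 : ((7 / 5) * Real.exp a - 12 * a + 11) / (2 * a) ≤ A := by
    rw [div_le_iff₀ (by linarith)]; linarith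
  have hkey : ((7 / 5) * Real.exp a - 12 * a + 11) / (2 * a) - 8 + Real.log π < Real.log (9 / 4 + t / 2) := by linarith
  have hexp : π * Real.exp (((7 / 5) * Real.exp a - 12 * a + 11) / (2 * a) - 8) < 9 / 4 + t / 2 := by
    have h1 := Real.exp_lt_exp.2 hkey
    rw [Real.exp_log (by positivity), Real.exp_add, Real.exp_log Real.pi_pos] at h1
    linarith
  -- t = π Be / a
  have ht' : t = π * Be / a := by rw [ht_def, freq]; push_cast; ring
  rw [ht'] at hexp
  -- solve for Be
  have hBe_eq : (2 * a / π) * (π * Be / a / 2) = Be := by field_simp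
  calc 2 * a / π * (π * Real.exp ((7 / 5 * Real.exp a - 12 * a + 11) / (2 * a) - 8) - 9 / 4)
      < (2 * a / π) * (π * Be / a / 2) := by
        refine mul_lt_mul_of_pos_left ?_ (by positivity)
        linarith
    _ = Be := hBe_eq

end FloorGrowth

end Summit.RiemannHypothesis.RiemannHypothesis.Theorems.WeilFormatC
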